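import Mathlib
import Summits.Ventures.PercRepro2.Defs
import Summits.Ventures.PercRepro2.Independence
import Summits.Ventures.PercRepro2.Harris
import Summits.Ventures.PercRepro2.Graph
import Summits.Ventures.PercRepro2.Exploration
import Summits.Ventures.PercRepro2.Events
import Summits.Ventures.PercRepro2.FourFunctions
import Summits.Ventures.PercRepro2.Induced
import Summits.Ventures.PercRepro2.Frontier
import Summits.Ventures.PercRepro2.ObsIndependence
import Summits.Ventures.PercRepro2.BHK
import Summits.Ventures.PercRepro2.BHKEvents
import Summits.Ventures.PercRepro2.CaseOneRegime
import Summits.Ventures.PercRepro2.CaseOnePos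
import Summits.Ventures.PercRepro2.CaseOneJ11

/-!
# The statement of record (RV) = (ii), form (b), as a Prop; the Z-split `(J1₁) = (i) + (ii)` in the
kernel (blind cell PercRepro2, p1 g13; ASSIGNMENTS v12.47 «p1: the Prop for (RV) form (b) —
definition only, with γ = P^{PD}(o ∈ C₁ ∪ C₂)»; lead g24 tri/README, mine-a §53, mine-1 §10.1)

Five marks on a finite graph, `Q = {a₁ ↮ a₂}`, `T′ = Q ∩ {a₃ ∈ C₁}` (`Tp`), `PD = Q ∩ {a₃ ∉ U}`,
`D = P(PD)` (`Dpd`), `D_o = P(PD, o ∈ U)` (`Dpdo`), `γ = D_o / D = P^{PD}(o ∈ C₁ ∪ C₂)` — NEVER the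
`C₂`-only variant (NEG-119: every other threshold dies). The non-table statement of record of the
cross term `(J1)` is

  **(RV) = (ii):  `Cov¹(b, o) + (P_Q(b ∈ C₂) − P¹(b ∈ C₂)) · (γ − P¹(o ∈ C₂)) ≥ 0`**

(`Cov¹`, `P¹` under `P(· ∣ T′)`, `P_Q` under `P(· ∣ Q)`): the same-cluster PA defect of `C₂` in the
required-vertex world `{a₃ ∈ C₁}` is paid by the product of the BHK 1.4 drop of `{b ∈ C₂}` and the
odds-lemma slack of `{o ∈ C₂}`. Cleared by `P(T′)² · P(Q) · D` it is **`rvExpr`**, and **`RV := 0 ≤ rvExpr`**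
— a definition only (census: n = 5 FULL; n = 6 FULL × 3 palettes (j229317); exhaustive binary-extreme
n = 6 m ≤ 10 × {1,7}/8, {1,127}/128, 2 × 24,238,080 instances (j229664): 0 failures; SHARP on the
theta graph; mine-a: not in the degree-1 table cone).

Also the Z-split of mine-1 / the lead (`(J1₁) = (i) + (ii)`), cleared by `D · P(Q)²`:
`iiExpr = D P(Q)² Cov_μ(1[b ∈ C₂], 1[a₃ ∈ C₁](1[o ∈ C₂] − γ))` (**`ZSplitII := 0 ≤ iiExpr`**, = (ii)),
`iExpr = −D P(Q)² Cov_μ(1[b ∈ C₁], 1[a₃ ∈ C₁](1[o ∈ C₂] − γ))` (**`ZSplitI := 0 ≤ iExpr`**, = (i)), and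
the kernel facts **`rvExpr_eq`**: `rvExpr = P(T′) · iiExpr` (so **`rv_iff_ii`** when `P(T′) > 0`),
**`jOneOneExpr_eq_i_add_ii`**: the cleared `(J1₁)` of `CaseOneJ11.lean` is `iExpr + iiExpr`, hence
**`jOneOne_of_i_of_ii`**: `(i) ∧ (ii) ⟹ (J1₁)`. Definitions and identities only. -/

namespace Summit.Ventures.PercRepro2

namespace CaseOne

section Defs
variable {V : Type*} {E : Type*} [Fintype E] [DecidableEq E] {R : Type*} [CommRing R]

/-- `T′ = Q ∩ {a₃ ∈ C₁}`, the required-vertex world. -/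
def Tp (ends : E → Sym2 V) (a₁ a₂ a₃ : V) : Set (Config E) :=
  (connEvent ends a₁ a₂)ᶜ ∩ connEvent ends a₁ a₃

/-- **(RV), form (b), cleared by `P(T′)² P(Q) D`**:
`P(Q) D [P(T′) P(T′, b, o ∈ C₂) − P(T′, b ∈ C₂) P(T′, o ∈ C₂)] + [P(T′) P(Q, b ∈ C₂) − P(Q) P(T′, b ∈ C₂)] ·
[P(T′) D_o − D P(T′, o ∈ C₂)]`. -/
noncomputable def rvExpr (p : E → R) (ends : E → Sym2 V) (o a₁ a₂ a₃ b : V) : R :=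
  prob p (connEvent ends a₁ a₂)ᶜ * Dpd p ends a₁ a₂ a₃ *
      (prob p (Tp ends a₁ a₂ a₃) * prob p (Tp ends a₁ a₂ a₃ ∩ connEvent ends a₂ b ∩ connEvent ends a₂ o) -
        prob p (Tp ends a₁ a₂ a₃ ∩ connEvent ends a₂ b) * prob p (Tp ends a₁ a₂ a₃ ∩ connEvent ends a₂ o)) +
    (prob p (Tp ends a₁ a₂ a₃) * prob p ((connEvent ends a₁ a₂)ᶜ ∩ connEvent ends a₂ b) -
        prob p (connEvent ends a₁ a₂)ᶜ * prob p (Tp ends a₁ a₂ a₃ ∩ connEvent ends a₂ b)) *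
      (prob p (Tp ends a₁ a₂ a₃) * Dpdo p ends o a₁ a₂ a₃ -
        Dpd p ends a₁ a₂ a₃ * prob p (Tp ends a₁ a₂ a₃ ∩ connEvent ends a₂ o))

/-- The cleared inner function `1[a₃ ∈ C₁] · (D · 1[o ∈ C₂] − D_o)` (`= D · 1[a₃ ∈ C₁](1[o ∈ C₂] − γ)`). -/
noncomputable def zFun (p : E → R) (ends : E → Sym2 V) (o a₁ a₂ a₃ : V) (ω : Config E) : R :=
  (connEvent ends a₁ a₃).indicator 1 ω *
    (Dpd p ends a₁ a₂ a₃ * (connEvent ends a₂ o).indicator 1 ω - Dpdo p ends o a₁ a₂ a₃)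

/-- **(ii), cleared by `D P(Q)²`**: `P(Q) E[1_{b∈C₂} Z 1_Q] − E[1_{b∈C₂} 1_Q] E[Z 1_Q]`, `Z = zFun`. -/
noncomputable def iiExpr (p : E → R) (ends : E → Sym2 V) (o a₁ a₂ a₃ b : V) : R :=
  prob p (connEvent ends a₁ a₂)ᶜ *
      expect p (fun ω => (connEvent ends a₂ b).indicator 1 ω * zFun p ends o a₁ a₂ a₃ ω *
        ((connEvent ends a₁ a₂)ᶜ).indicator 1 ω) -
    expect p (fun ω => (connEvent ends a₂ b).indicator 1 ω * ((connEvent ends a₁ a₂)ᶜ).indicator 1 ω) *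
      expect p (fun ω => zFun p ends o a₁ a₂ a₃ ω * ((connEvent ends a₁ a₂)ᶜ).indicator 1 ω)

/-- **(i), cleared by `D P(Q)²`**: `−[P(Q) E[1_{b∈C₁} Z 1_Q] − E[1_{b∈C₁} 1_Q] E[Z 1_Q]]`. -/
noncomputable def iExpr (p : E → R) (ends : E → Sym2 V) (o a₁ a₂ a₃ b : V) : R :=
  -(prob p (connEvent ends a₁ a₂)ᶜ *
      expect p (fun ω => (connEvent ends a₁ b).indicator 1 ω * zFun p ends o a₁ a₂ a₃ ω *
        ((connEvent ends a₁ a₂)ᶜ).indicator 1 ω) -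
    expect p (fun ω => (connEvent ends a₁ b).indicator 1 ω * ((connEvent ends a₁ a₂)ᶜ).indicator 1 ω) *
      expect p (fun ω => zFun p ends o a₁ a₂ a₃ ω * ((connEvent ends a₁ a₂)ᶜ).indicator 1 ω))

end Defs

section Props
variable {V : Type*} {E : Type*} [Fintype E] [DecidableEq E] {R : Type*} [CommRing R] [LinearOrder R]

/-- **(RV) = (ii), the non-table statement of record of the (J1) line** (ASSIGNMENTS v12.47), form
(b), cleared: `0 ≤ rvExpr`. A definition only. -/
def RV (p : E → R) (ends : E → Sym2 V) (o a₁ a₂ a₃ b : V) : Prop :=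
  0 ≤ rvExpr p ends o a₁ a₂ a₃ b

/-- **(ii) of the Z-split**, cleared: `Cov_μ(1[b ∈ C₂], 1[a₃ ∈ C₁](1[o ∈ C₂] − γ)) ≥ 0`. A definition only. -/
def ZSplitII (p : E → R) (ends : E → Sym2 V) (o a₁ a₂ a₃ b : V) : Prop :=
  0 ≤ iiExpr p ends o a₁ a₂ a₃ b

/-- **(i) of the Z-split**, cleared: `Cov_μ(1[b ∈ C₁], 1[a₃ ∈ C₁](1[o ∈ C₂] − γ)) ≤ 0`. A definition only. -/
def ZSplitI (p : E → R) (ends : E → Sym2 V) (o a₁ a₂ a₃ b : V) : Prop :=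
  0 ≤ iExpr p ends o a₁ a₂ a₃ b

end Props

/-! ## Expectations of indicator products are probabilities -/

section Products
variable {V : Type*} {E : Type*} [Fintype E] [DecidableEq E] {R : Type*} [CommRing R]

omit [Fintype E] [DecidableEq E] in
/-- `1_A · 1_B = 1_{A ∩ B}` pointwise (the cell's `indicator_inter_one`, reversed). -/
lemma ind_mul (A B : Set (Config E)) (ω : Config E) :
    A.indicator (1 : Config E → R) ω * B.indicator 1 ω = (A ∩ B).indicator 1 ω :=
  (indicator_inter_one A B ω).symm

/-- `E[1_A 1_B] = P(A ∩ B)`. -/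
lemma expect_ind2 (p : E → R) (A B : Set (Config E)) :
    expect p (fun ω => A.indicator (1 : Config E → R) ω * B.indicator 1 ω) = prob p (A ∩ B) := by
  rw [prob_eq_expect_indicator]
  congr 1
  funext ω
  exact ind_mul A B ω

/-- `E[1_A 1_B 1_C] = P(A ∩ B ∩ C)`. -/
lemma expect_ind3 (p : E → R) (A B C : Set (Config E)) :
    expect p (fun ω => A.indicator (1 : Config E → R) ω * B.indicator 1 ω * C.indicator 1 ω) =
      prob p (A ∩ B ∩ C) := by
  rw [prob_eq_expect_indicator]
  congr 1
  funext ω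
  rw [ind_mul, ind_mul]

/-- `E[1_A 1_B 1_C 1_D] = P(A ∩ B ∩ C ∩ D)`. -/
lemma expect_ind4 (p : E → R) (A B C D : Set (Config E)) :
    expect p (fun ω => A.indicator (1 : Config E → R) ω * B.indicator 1 ω * C.indicator 1 ω *
      D.indicator 1 ω) = prob p (A ∩ B ∩ C ∩ D) := by
  rw [prob_eq_expect_indicator]
  congr 1
  funext ω
  rw [ind_mul, ind_mul, ind_mul]

/-- `E[f · (c₁ g − c₂) · h] = c₁ E[f g h] − c₂ E[f h]`. -/
lemma expect_mul_affine (p : E → R) (f g h : Config E → R) (c₁ c₂ : R) :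
    expect p (fun ω => f ω * (c₁ * g ω - c₂) * h ω) =
      c₁ * expect p (fun ω => f ω * g ω * h ω) - c₂ * expect p (fun ω => f ω * h ω) := by
  rw [← expect_const_mul, ← expect_const_mul, ← expect_sub]
  congr 1
  funext ω
  simp only [Pi.sub_apply]
  ring

/-- `E[(c₁ g − c₂) · h] = c₁ E[g h] − c₂ E[h]`. -/
lemma expect_affine (p : E → R) (g h : Config E → R) (c₁ c₂ : R) :
    expect p (fun ω => (c₁ * g ω - c₂) * h ω) =
      c₁ * expect p (fun ω => g ω * h ω) - c₂ * expect p h := by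
  rw [← expect_const_mul, ← expect_const_mul, ← expect_sub]
  congr 1
  funext ω
  simp only [Pi.sub_apply]
  ring

end Products

/-! ## (RV) = P(T′) · (ii) -/

section RVii
variable {V : Type*} {E : Type*} [Fintype E] [DecidableEq E] {R : Type*} [CommRing R]

/-- `iiExpr` in event probabilities. -/
lemma iiExpr_eq_probs (p : E → R) (ends : E → Sym2 V) (o a₁ a₂ a₃ b : V) :
    iiExpr p ends o a₁ a₂ a₃ b =
      prob p (connEvent ends a₁ a₂)ᶜ *
          (Dpd p ends a₁ a₂ a₃ * prob p (connEvent ends a₂ b ∩ connEvent ends a₁ a₃ ∩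
              connEvent ends a₂ o ∩ (connEvent ends a₁ a₂)ᶜ) -
            Dpdo p ends o a₁ a₂ a₃ * prob p (connEvent ends a₂ b ∩ connEvent ends a₁ a₃ ∩
              (connEvent ends a₁ a₂)ᶜ)) -
        prob p (connEvent ends a₂ b ∩ (connEvent ends a₁ a₂)ᶜ) *
          (Dpd p ends a₁ a₂ a₃ * prob p (connEvent ends a₁ a₃ ∩ connEvent ends a₂ o ∩
              (connEvent ends a₁ a₂)ᶜ) -
            Dpdo p ends o a₁ a₂ a₃ * prob p (connEvent ends a₁ a₃ ∩ (connEvent ends a₁ a₂)ᶜ)) := by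
  unfold iiExpr zFun
  have e1 : expect p (fun ω => (connEvent ends a₂ b).indicator (1 : Config E → R) ω *
      ((connEvent ends a₁ a₃).indicator 1 ω *
        (Dpd p ends a₁ a₂ a₃ * (connEvent ends a₂ o).indicator 1 ω - Dpdo p ends o a₁ a₂ a₃)) *
      ((connEvent ends a₁ a₂)ᶜ).indicator 1 ω) =
      expect p (fun ω => ((connEvent ends a₂ b).indicator (1 : Config E → R) ω *
        (connEvent ends a₁ a₃).indicator 1 ω) *
        (Dpd p ends a₁ a₂ a₃ * (connEvent ends a₂ o).indicator 1 ω - Dpdo p ends o a₁ a₂ a₃) *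
        ((connEvent ends a₁ a₂)ᶜ).indicator 1 ω) := by
    congr 1
    funext ω
    ring
  rw [e1, expect_mul_affine, expect_mul_affine]
  simp only [expect_ind4, expect_ind3, expect_ind2]

omit [Fintype E] [DecidableEq E] in
/-- `Q ∩ A₁ = T′` and the event rewrites. -/
lemma set_rv1 (ends : E → Sym2 V) (o a₁ a₂ a₃ b : V) :
    connEvent ends a₂ b ∩ connEvent ends a₁ a₃ ∩ connEvent ends a₂ o ∩ (connEvent ends a₁ a₂)ᶜ =
      Tp ends a₁ a₂ a₃ ∩ connEvent ends a₂ b ∩ connEvent ends a₂ o := by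
  ext ω; simp only [Tp, Set.mem_inter_iff]; tauto

omit [Fintype E] [DecidableEq E] in
/-- `{b ∈ C₂} ∩ {a₃ ∈ C₁} ∩ Q = T′ ∩ {b ∈ C₂}`. -/
lemma set_rv2 (ends : E → Sym2 V) (a₁ a₂ a₃ b : V) :
    connEvent ends a₂ b ∩ connEvent ends a₁ a₃ ∩ (connEvent ends a₁ a₂)ᶜ =
      Tp ends a₁ a₂ a₃ ∩ connEvent ends a₂ b := by
  ext ω; simp only [Tp, Set.mem_inter_iff]; tauto

omit [Fintype E] [DecidableEq E] in
/-- `{a₃ ∈ C₁} ∩ {o ∈ C₂} ∩ Q = T′ ∩ {o ∈ C₂}`. -/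
lemma set_rv3 (ends : E → Sym2 V) (o a₁ a₂ a₃ : V) :
    connEvent ends a₁ a₃ ∩ connEvent ends a₂ o ∩ (connEvent ends a₁ a₂)ᶜ =
      Tp ends a₁ a₂ a₃ ∩ connEvent ends a₂ o := by
  ext ω; simp only [Tp, Set.mem_inter_iff]; tauto

omit [Fintype E] [DecidableEq E] in
/-- `{a₃ ∈ C₁} ∩ Q = T′`. -/
lemma set_rv4 (ends : E → Sym2 V) (a₁ a₂ a₃ : V) :
    connEvent ends a₁ a₃ ∩ (connEvent ends a₁ a₂)ᶜ = Tp ends a₁ a₂ a₃ := by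
  ext ω; simp only [Tp, Set.mem_inter_iff]; tauto

omit [Fintype E] [DecidableEq E] in
/-- `{b ∈ C₂} ∩ Q = Q ∩ {b ∈ C₂}`. -/
lemma set_rv5 (ends : E → Sym2 V) (a₁ a₂ b : V) :
    connEvent ends a₂ b ∩ (connEvent ends a₁ a₂)ᶜ = (connEvent ends a₁ a₂)ᶜ ∩ connEvent ends a₂ b := by
  ext ω; simp only [Set.mem_inter_iff]; tauto

/-- **`rvExpr = P(T′) · iiExpr`**: the lead's form (b) of (RV) is (ii) up to the positive factor
`P(T′)` (an exact identity in the event probabilities). -/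
theorem rvExpr_eq (p : E → R) (ends : E → Sym2 V) (o a₁ a₂ a₃ b : V) :
    rvExpr p ends o a₁ a₂ a₃ b = prob p (Tp ends a₁ a₂ a₃) * iiExpr p ends o a₁ a₂ a₃ b := by
  rw [iiExpr_eq_probs, set_rv1, set_rv2, set_rv3, set_rv4, set_rv5]
  unfold rvExpr
  ring

end RVii

section RViiOrder
variable {V : Type*} {E : Type*} [Fintype E] [DecidableEq E] {R : Type*} [CommRing R] [LinearOrder R]
  [IsStrictOrderedRing R]

/-- **`RV ⟺ (ii)`** whenever the required-vertex world has positive mass. -/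
theorem rv_iff_ii (p : E → R) (ends : E → Sym2 V) (o a₁ a₂ a₃ b : V)
    (hT : 0 < prob p (Tp ends a₁ a₂ a₃)) :
    RV p ends o a₁ a₂ a₃ b ↔ ZSplitII p ends o a₁ a₂ a₃ b := by
  unfold RV ZSplitII
  rw [rvExpr_eq]
  constructor
  · intro h
    exact nonneg_of_mul_nonneg_right (by linarith) hT
  · intro h
    exact mul_nonneg hT.le h

end RViiOrder

/-! ## The Z-split: `(J1₁) = (i) + (ii)` -/

section ZSplit
variable {V : Type*} {E : Type*} [Fintype E] [DecidableEq E] {R : Type*} [CommRing R]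

omit [Fintype E] [DecidableEq E] in
/-- A cluster-membership indicator is a connection indicator. -/
lemma ind_cluster_eq (ends : E → Sym2 V) (x v : V) (ω : Config E) :
    ({S : Set V | v ∈ S}).indicator (1 : Set V → R) (cluster ends ω x) =
      (connEvent ends x v).indicator 1 ω := by
  by_cases hx : Conn ends ω x v
  · simp only [Set.indicator_of_mem (show cluster ends ω x ∈ {S : Set V | v ∈ S} from hx),
      Set.indicator_of_mem (show ω ∈ connEvent ends x v from hx), Pi.one_apply]
  · simp only [Set.indicator_of_notMem (show cluster ends ω x ∉ {S : Set V | v ∈ S} from hx),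
      Set.indicator_of_notMem (show ω ∉ connEvent ends x v from hx)]

/-- **The cleared `(J1₁)` of `CaseOneJ11.lean` is `(i) + (ii)`**: with `Q`-expectations
`D_o · covExpr 1[a₃ ∈ ·] − D · covExprC (1[a₃ ∈ C₁] 1[o ∈ C₂]) = iExpr + iiExpr`. -/
theorem jOneOneExpr_eq_i_add_ii (p : E → R) (ends : E → Sym2 V) (o a₁ a₂ a₃ b : V) :
    Dpdo p ends o a₁ a₂ a₃ * covExpr p ends a₁ a₂ b (({W' : Set V | a₃ ∈ W'}).indicator 1) -
      Dpd p ends a₁ a₂ a₃ * covExprC p ends a₁ a₂ b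
        (fun ω => ({W' : Set V | a₃ ∈ W'}).indicator 1 (cluster ends ω a₁) *
          ({S : Set V | o ∈ S}).indicator 1 (cluster ends ω a₂)) =
      iExpr p ends o a₁ a₂ a₃ b + iiExpr p ends o a₁ a₂ a₃ b := by
  unfold covExpr covExprC iExpr iiExpr zFun
  simp only [ind_cluster_eq, sigmaB_eq]
  -- name the atoms
  set Q := (connEvent ends a₁ a₂)ᶜ with hQ
  set IB1 := (connEvent ends a₁ b).indicator (1 : Config E → R) with hIB1
  set IB2 := (connEvent ends a₂ b).indicator (1 : Config E → R) with hIB2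
  set IA := (connEvent ends a₁ a₃).indicator (1 : Config E → R) with hIA
  set IO := (connEvent ends a₂ o).indicator (1 : Config E → R) with hIO
  set IQ := Q.indicator (1 : Config E → R) with hIQ
  set D := Dpd p ends a₁ a₂ a₃ with hD
  set Do := Dpdo p ends o a₁ a₂ a₃ with hDo
  -- expand every expectation into the atoms `E[IB1 IA IQ]`, `E[IB2 IA IQ]`, `E[IB1 IQ]`, `E[IB2 IQ]`,
  -- `E[IA IQ]`, `E[IB1 IA IO IQ]`, `E[IB2 IA IO IQ]`, `E[IA IO IQ]`
  have e1 : expect p (fun ω => (IB1 ω - IB2 ω) * IA ω * IQ ω) =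
      expect p (fun ω => IB1 ω * IA ω * IQ ω) - expect p (fun ω => IB2 ω * IA ω * IQ ω) := by
    rw [← expect_sub]; congr 1; funext ω; simp only [Pi.sub_apply]; ring
  have e2 : expect p (fun ω => (IB1 ω - IB2 ω) * IQ ω) =
      expect p (fun ω => IB1 ω * IQ ω) - expect p (fun ω => IB2 ω * IQ ω) := by
    rw [← expect_sub]; congr 1; funext ω; simp only [Pi.sub_apply]; ring
  have e3 : expect p (fun ω => (IB1 ω - IB2 ω) * (IA ω * IO ω) * IQ ω) =
      expect p (fun ω => IB1 ω * IA ω * IO ω * IQ ω) -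
        expect p (fun ω => IB2 ω * IA ω * IO ω * IQ ω) := by
    rw [← expect_sub]; congr 1; funext ω; simp only [Pi.sub_apply]; ring
  have e4 : expect p (fun ω => IB1 ω * (IA ω * (D * IO ω - Do)) * IQ ω) =
      D * expect p (fun ω => IB1 ω * IA ω * IO ω * IQ ω) -
        Do * expect p (fun ω => IB1 ω * IA ω * IQ ω) := by
    rw [← expect_const_mul, ← expect_const_mul, ← expect_sub]; congr 1; funext ω
    simp only [Pi.sub_apply]; ring
  have e5 : expect p (fun ω => IB2 ω * (IA ω * (D * IO ω - Do)) * IQ ω) =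
      D * expect p (fun ω => IB2 ω * IA ω * IO ω * IQ ω) -
        Do * expect p (fun ω => IB2 ω * IA ω * IQ ω) := by
    rw [← expect_const_mul, ← expect_const_mul, ← expect_sub]; congr 1; funext ω
    simp only [Pi.sub_apply]; ring
  have e6 : expect p (fun ω => IA ω * (D * IO ω - Do) * IQ ω) =
      D * expect p (fun ω => IA ω * IO ω * IQ ω) - Do * expect p (fun ω => IA ω * IQ ω) := by
    rw [← expect_const_mul, ← expect_const_mul, ← expect_sub]; congr 1; funext ω
    simp only [Pi.sub_apply]; ring
  rw [e1, e2, e3, e4, e5, e6]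
  ring

end ZSplit

section ZSplitOrder
variable {V : Type*} {E : Type*} [Fintype E] [DecidableEq E] {R : Type*} [CommRing R] [LinearOrder R]
  [IsStrictOrderedRing R]

/-- **`(i) ∧ (ii) ⟹ (J1₁)`** (the Z-split; `JOneOne` of `CaseOneJ11.lean`). -/
theorem jOneOne_of_i_of_ii (p : E → R) (ends : E → Sym2 V) (o a₁ a₂ a₃ b : V)
    (hi : ZSplitI p ends o a₁ a₂ a₃ b) (hii : ZSplitII p ends o a₁ a₂ a₃ b) :
    JOneOne p ends o a₁ a₂ a₃ b := by
  unfold ZSplitI at hi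
  unfold ZSplitII at hii
  unfold JOneOne
  have h := jOneOneExpr_eq_i_add_ii p ends o a₁ a₂ a₃ b
  linarith

/-- **`(i) ∧ (RV) ⟹ (J1₁)`** when the required-vertex world has positive mass. -/
theorem jOneOne_of_i_of_rv (p : E → R) (ends : E → Sym2 V) (o a₁ a₂ a₃ b : V)
    (hT : 0 < prob p (Tp ends a₁ a₂ a₃)) (hi : ZSplitI p ends o a₁ a₂ a₃ b)
    (hrv : RV p ends o a₁ a₂ a₃ b) : JOneOne p ends o a₁ a₂ a₃ b :=
  jOneOne_of_i_of_ii p ends o a₁ a₂ a₃ b hi ((rv_iff_ii p ends o a₁ a₂ a₃ b hT).1 hrv)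

end ZSplitOrder

end CaseOne

end Summit.Ventures.PercRepro2
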